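import Mathlib
import Summits.Ventures.PercRepro2.HCov
import Summits.Ventures.PercRepro2.A3Fibre
import Summits.Ventures.PercRepro2.A3FibreA
import Summits.Ventures.PercRepro2.A3FibreFactors
import Summits.Ventures.PercRepro2.A3FibreMain
import Summits.Ventures.PercRepro2.A3BetweenSwap
import Summits.Ventures.PercRepro2.A3BetweenNull

/-!
# (MEANS-a₃) at `D = 0`: the dichotomy, and the clean class reduction
`A3Between_all ↔ A3BetweenNoRootEdge_all` (blind cell PercRepro2, p5 g14; part 2; `proofs/P5-ROOTEDGE.md` §7)

THE DICHOTOMY (**`T_null_or_T'_null_of_PD_null`**): `P(PD) = 0` forces `P(T) = 0` or `P(T′) = 0` — the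
pointwise meet of a positive-weight configuration of `T` with one of `T′` has positive weight
(`weight_meet_pos`: each edge factor of the meet is one of the two positive factors), lies in `Q`
(decreasing) and has `a₃ ∉ C₁ ∪ C₂` (monotonicity of connection, `conn_mono`), i.e. lies in `PD`.
With A3BetweenNull's `A3Between_of_T_null` (and the root swap `A3Between_swap` for the `T′`-null
case): **`A3Between_of_PD_null`** — (MEANS-a₃) holds whenever `D = P(PD) = 0` — and hence
**`A3Between_of_noRootEdge_class'`** (no `D > 0` proviso) and the `_all`-level equivalence
**`A3Between_all_iff_noRootEdge_all : A3Between_all R ↔ A3BetweenNoRootEdge_all R`**, the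
means-level analogue of `HCov_all_iff_noRootEdge_all`.
-/

namespace Summit.Ventures.PercRepro2

open UnionCluster

namespace CovForm

namespace RootEdge

open CCT A3Fibre

section Dichotomy

variable {V : Type*} {E : Type*} [Fintype V] [DecidableEq V] [Fintype E] [DecidableEq E]
  {R : Type*} [Field R] [LinearOrder R] [IsStrictOrderedRing R]

variable {ends : E → Sym2 V} {a₁ a₂ a₃ : V}

omit [Fintype V] [DecidableEq V] in
/-- A positive-weight configuration exists in every event of positive probability. -/
lemma exists_weight_pos_of_prob_pos (p : E → R) (hp : IsProbVec p) {X : Set (Config E)}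
    (hX : 0 < prob p X) : ∃ ω ∈ X, 0 < weight p ω := by
  by_contra h
  have h' : ∀ ω ∈ X, weight p ω = 0 := fun ω hω =>
    le_antisymm (not_lt.1 fun hc => h ⟨ω, hω, hc⟩) (weight_nonneg hp ω)
  have : prob p X = 0 := by
    unfold prob
    refine Finset.sum_eq_zero fun ω _ => ?_
    by_cases hω : ω ∈ X
    · rw [Set.indicator_of_mem hω]
      exact h' ω hω
    · exact Set.indicator_of_notMem hω _
  exact absurd this hX.ne'

omit [Fintype V] [DecidableEq V] [DecidableEq E] [LinearOrder R] [IsStrictOrderedRing R] in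
/-- The pointwise meet of two configurations. -/
def meetConfig (ω₁ ω₂ : Config E) : Config E := fun e => ω₁ e && ω₂ e

omit [Fintype V] [DecidableEq V] [Fintype E] [DecidableEq E] [LinearOrder R]
  [IsStrictOrderedRing R] in
/-- The meet is below its left argument. -/
lemma meetConfig_le_left (ω₁ ω₂ : Config E) : meetConfig ω₁ ω₂ ≤ ω₁ := fun e => by
  simp only [meetConfig]; cases ω₁ e <;> cases ω₂ e <;> simp

omit [Fintype V] [DecidableEq V] [Fintype E] [DecidableEq E] [LinearOrder R]
  [IsStrictOrderedRing R] in
/-- The meet is below its right argument. -/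
lemma meetConfig_le_right (ω₁ ω₂ : Config E) : meetConfig ω₁ ω₂ ≤ ω₂ := fun e => by
  simp only [meetConfig]; cases ω₁ e <;> cases ω₂ e <;> simp

omit [Fintype V] [DecidableEq V] [DecidableEq E] in
/-- A positive edge factor. -/
lemma edgeFactor_pos_iff (q : R) (b : Bool) :
    0 < edgeFactor q b ↔ (b = true ∧ 0 < q) ∨ (b = false ∧ q < 1) := by
  cases b <;> simp [edgeFactor, sub_pos]

omit [Fintype V] [DecidableEq V] [DecidableEq E] in
/-- Every edge factor of a positive-weight configuration is positive. -/
lemma edgeFactor_pos_of_weight_pos (p : E → R) (hp : IsProbVec p) {ω : Config E}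
    (h : 0 < weight p ω) (e : E) : 0 < edgeFactor (p e) (ω e) := by
  by_contra hc
  have h0 : edgeFactor (p e) (ω e) = 0 := by
    refine le_antisymm (not_lt.1 hc) ?_
    cases hb : ω e <;> simp [edgeFactor] <;> linarith [hp.nonneg e, hp.le_one e]
  have : weight p ω = 0 := by
    unfold weight
    exact Finset.prod_eq_zero (Finset.mem_univ e) h0
  exact absurd this h.ne'

omit [Fintype V] [DecidableEq V] [DecidableEq E] in
/-- The meet of two positive-weight configurations has positive weight. -/
lemma weight_meet_pos (p : E → R) (hp : IsProbVec p) {ω₁ ω₂ : Config E} (h₁ : 0 < weight p ω₁)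
    (h₂ : 0 < weight p ω₂) : 0 < weight p (meetConfig ω₁ ω₂) := by
  unfold weight
  refine Finset.prod_pos fun e _ => ?_
  have f₁ := (edgeFactor_pos_iff (p e) (ω₁ e)).1 (edgeFactor_pos_of_weight_pos p hp h₁ e)
  have f₂ := (edgeFactor_pos_iff (p e) (ω₂ e)).1 (edgeFactor_pos_of_weight_pos p hp h₂ e)
  rw [edgeFactor_pos_iff]
  simp only [meetConfig]
  rcases f₁ with ⟨hb, hq⟩ | ⟨hb, hq⟩ <;> rcases f₂ with ⟨hb', hq'⟩ | ⟨hb', hq'⟩ <;>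
    simp [hb, hb', hq, hq']

omit [Fintype V] [DecidableEq V] in
/-- **The dichotomy**: `P(PD) = 0` forces `P(T) = 0` or `P(T′) = 0`. -/
theorem T_null_or_T'_null_of_PD_null (p : E → R) (hp : IsProbVec p)
    (hPD : prob p (PDEvent ends a₁ a₂ a₃) = 0) :
    prob p (TEvent ends a₁ a₂ a₃) = 0 ∨ prob p (TEvent ends a₂ a₁ a₃) = 0 := by
  by_contra h
  rw [not_or] at h
  obtain ⟨hT, hT'⟩ := h
  have hTpos : 0 < prob p (TEvent ends a₁ a₂ a₃) := lt_of_le_of_ne (prob_nonneg hp _) (Ne.symm hT)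
  have hT'pos : 0 < prob p (TEvent ends a₂ a₁ a₃) := lt_of_le_of_ne (prob_nonneg hp _) (Ne.symm hT')
  obtain ⟨ω₁, hω₁, hw₁⟩ := exists_weight_pos_of_prob_pos p hp hTpos
  obtain ⟨ω₂, hω₂, hw₂⟩ := exists_weight_pos_of_prob_pos p hp hT'pos
  set ω₀ := meetConfig ω₁ ω₂ with hω₀
  have hw₀ := weight_meet_pos p hp hw₁ hw₂
  simp only [TEvent, Set.mem_inter_iff, Set.mem_compl_iff, mem_connEvent] at hω₁ hω₂
  -- `ω₀ ∈ PD`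
  have hmem : ω₀ ∈ PDEvent ends a₁ a₂ a₃ := by
    refine ⟨?_, ?_⟩
    · simp only [Set.mem_compl_iff, mem_connEvent]
      exact fun hc => hω₁.1 (conn_symm (conn_mono (meetConfig_le_left ω₁ ω₂) hc))
    · simp only [Dtilde, Set.mem_compl_iff, mem_inU, not_or]
      refine ⟨fun hc => ?_, fun hc => ?_⟩
      · -- `a₃ ↔ a₁` in `ω₀ ≤ ω₁`, but in `ω₁`: `a₂ ↔ a₃` and `a₂ ↮ a₁`
        exact hω₁.1 (conn_trans hω₁.2 (conn_mono (meetConfig_le_left ω₁ ω₂) hc))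
      · -- `a₃ ↔ a₂` in `ω₀ ≤ ω₂`, but in `ω₂`: `a₁ ↔ a₃` and `a₁ ↮ a₂`
        exact hω₂.1 (conn_trans hω₂.2 (conn_mono (meetConfig_le_right ω₁ ω₂) hc))
  have : 0 < prob p (PDEvent ends a₁ a₂ a₃) := by
    unfold prob
    refine lt_of_lt_of_le hw₀ ?_
    calc weight p ω₀ = (PDEvent ends a₁ a₂ a₃).indicator (weight p) ω₀ := by
          rw [Set.indicator_of_mem hmem]
      _ ≤ ∑ ω, (PDEvent ends a₁ a₂ a₃).indicator (weight p) ω :=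
          Finset.single_le_sum (fun ω _ => Set.indicator_nonneg (fun ω' _ => weight_nonneg hp ω') ω)
            (Finset.mem_univ ω₀)
  exact absurd hPD this.ne'

/-- **(MEANS-a₃) whenever `D = P(PD) = 0`**: the dichotomy and `A3Between_of_T_null` (with the root
swap for the `T′`-null case; `P(Q) = 0` is the `T`-null case with everything null). -/
theorem A3Between_of_PD_null (p : E → R) (hp : IsProbVec p) (o b : V)
    (hPD : prob p (PDEvent ends a₁ a₂ a₃) = 0) : A3Between p ends o a₁ a₂ a₃ b := by
  rcases T_null_or_T'_null_of_PD_null p hp hPD with hT | hT'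
  · exact A3Between_of_T_null p hp o b hPD hT
  · rw [← A3Between_swap]
    rw [← PDEvent_swap] at hPD
    exact A3Between_of_T_null p hp o b hPD hT'

end Dichotomy

section All

variable {V : Type*} {E : Type*} [Fintype V] [DecidableEq V] [Fintype E] [DecidableEq E]
  {R : Type*} [Field R] [LinearOrder R] [IsStrictOrderedRing R]

/-- **(MEANS-a₃) from the class `NoRootEdge`, no `D > 0` proviso.** -/
theorem A3Between_of_noRootEdge_class' (p : E → R) (hp : IsProbVec p) (ends : E → Sym2 V)
    (o a₁ a₂ a₃ b : V)
    (h : ∀ p' : E → R, IsProbVec p' → NoRootEdge p' ends a₁ a₂ a₃ → A3Between p' ends o a₁ a₂ a₃ b) :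
    A3Between p ends o a₁ a₂ a₃ b := by
  rcases eq_or_lt_of_le (prob_nonneg hp (PDEvent ends a₁ a₂ a₃)) with hz | hpos
  · exact A3Between_of_PD_null p hp o b hz.symm
  · exact A3Between_of_noRootEdge_class p hp ends o a₁ a₂ a₃ b hpos h

end All

end RootEdge

open A3Fibre

section Closure

variable (R : Type*) [Field R] [LinearOrder R] [IsStrictOrderedRing R]

/-- **(MEANS-a₃) on every finite graph in which `a₃` has no root edge** (the binders of `A3Between_all`
plus `RootEdge.NoRootEdge`). -/
def A3BetweenNoRootEdge_all : Prop :=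
  ∀ (V E : Type) [Fintype V] [DecidableEq V] [Fintype E] [DecidableEq E]
    (ends : E → Sym2 V) (p : E → R), IsProbVec p →
    ∀ o a₁ a₂ a₃ b : V, a₁ ≠ a₂ → a₁ ≠ a₃ → a₂ ≠ a₃ → o ≠ a₁ → o ≠ a₂ → o ≠ a₃ → o ≠ b →
      b ≠ a₁ → b ≠ a₂ → b ≠ a₃ → RootEdge.NoRootEdge p ends a₁ a₂ a₃ → A3Between p ends o a₁ a₂ a₃ b

/-- **(MEANS-a₃) everywhere is equivalent to (MEANS-a₃) on graphs in which `a₃` has no root edge**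
(the means-level analogue of `HCov_all_iff_noRootEdge_all`, with no `D > 0` proviso). -/
theorem A3Between_all_iff_noRootEdge_all : A3Between_all R ↔ A3BetweenNoRootEdge_all R := by
  constructor
  · intro h V E _ _ _ _ ends p hp o a₁ a₂ a₃ b h1 h2 h3 h4 h5 h6 h7 h8 h9 h10 _
    exact h V E ends p hp o a₁ a₂ a₃ b h1 h2 h3 h4 h5 h6 h7 h8 h9 h10
  · intro h V E _ _ _ _ ends p hp o a₁ a₂ a₃ b h1 h2 h3 h4 h5 h6 h7 h8 h9 h10
    exact RootEdge.A3Between_of_noRootEdge_class' p hp ends o a₁ a₂ a₃ b fun p' hp' hn =>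
      h V E ends p' hp' o a₁ a₂ a₃ b h1 h2 h3 h4 h5 h6 h7 h8 h9 h10 hn

end Closure

end CovForm

end Summit.Ventures.PercRepro2
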